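import Summits.HubbardSuperconductivity.HubbardSuperconductivity.Theses.ParentFirstSMA
import Summits.HubbardSuperconductivity.HubbardSuperconductivity.Theorems.TwTipContinuation.Negative.TipNormalForm
import Literature.MathematicalPhysics.QuantumLattice.PairCorrelationsSupRayleighProofs
import Literature.MathematicalPhysics.QuantumLattice.PairFieldYangCeiling
import Literature.MathematicalPhysics.QuantumLattice.HubbardWave0PosSemidefProofs
import HarnessLib

/-!
# Crux `DiluteDWavePairsCondense` (stmt-HubbardSuperconductivity-10771), line `birth`: the condensation stub is NECESSARY

Helper for route `ParentFirstSMA` (`--supports stmt-HubbardSuperconductivity-10771`). The line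
`birth` (`Cruxes/DiluteDWavePairsCondense/Lines/birth.lean`) reaches the crux's conclusion at
`(U, δ)` — `d_{x²-y²}` pair-field long-range order of EVERY `(2⌊(1-δ)L²/2⌋, S^z = 0)` ground-state
sequence along even sides — from its stub `stub_pairCondensation` (every normalised sector ground
state has a unit `ρ₂`-eigenvector with eigenvalue `≥ c L²`, Yang's finite-volume ODLRO) and the
`d`-wave locking stub. This file proves the CONVERSE direction of that step, sorry-free:

* `exists_unit_eigenvector_rayleigh_le` — Rayleigh–Ritz in the `dotProduct` language: a Hermitian
  matrix has a unit eigenvector `(v, ev)` with `ev ≥ re ⟨w, ρ w⟩` for any unit `w`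
  (Horn–Johnson, Theorem 4.2.2 (c); the tree's `IsHermitian.re_dotProduct_mulVec_le` plus
  Mathlib's `eigenvectorBasis`);
* `pairCondensation_of_everyGSOrder` — a uniform every-ground-state order bound
  `c L⁴ ≤ re ⟨ψ, Δ_d† Δ_d ψ⟩` gives every such `ψ` a unit `ρ₂`-eigenvector with eigenvalue
  `≥ (c/4) L²`: `re ⟨ψ, Δ_d† Δ_d ψ⟩ = re (φ_d† ρ₂ φ_d)` (Yang's identity) and `‖φ_d‖² = 4L²`
  (`re_star_pairFieldWavefunction_dWave_dotProduct_self`), so the unit vector `φ_d / (2L)` has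
  Rayleigh quotient `≥ (c/4) L²`, dominated by the top eigenvalue of the Hermitian `ρ₂`;
* `pairCondensation_of_summitMatrix` — the crux's conclusion at `(U, δ)` (`δ ≥ -1`) implies the
  body of `stub_pairCondensation` at the same `δ`, via the tree's normal form
  `everyGSOrder_of_summitMatrix` (summit matrix at `(U, δ)` ⇔ uniform every-GS order bound);
* `pairCondensation_of_diluteDWavePairsCondense` — hence the crux `DiluteDWavePairsCondense`
  itself implies, for every `U ∈ [12, 24]` satisfying its hypotheses (a)–(c), the existence of a
  doping `δ ∈ (0, 1/2)` at which every normalised sector ground state of every large even torus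
  carries a macroscopic `ρ₂`-eigenvalue `≥ c L²`.

Consequence for the line (lead's census): `stub_pairCondensation` is not a proper weakening of the
crux — at the doping the crux produces, its body is IMPLIED by the crux's conclusion; the `ρ₂`
route re-expresses, it does not reduce, the `T = 0` condensation content of the BEC bridge.

References: C. N. Yang, Rev. Mod. Phys. 34 (1962) 694, §4 (ODLRO ⇔ macroscopic eigenvalue of
`ρ₂`, eq. (22)); R. A. Horn, C. R. Johnson, *Matrix Analysis* (2013), Theorem 4.2.2 (c);
D. J. Scalapino, Phys. Rep. 250 (1995) 329, §2 eq. (2.4). No definition is introduced.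
-/

-- the mandated namespace `Summit.<Summit>.<Problem>.Theorems` repeats `HubbardSuperconductivity`
-- (single-problem summit, D-0017), which the `dupNamespace` linter flags on every declaration
set_option linter.dupNamespace false

noncomputable section

namespace Summit.HubbardSuperconductivity.HubbardSuperconductivity.Theorems.ParentFirstSMA

open Matrix Finset Filter
open Literature.Probability.LatticeModels Literature.MathematicalPhysics.QuantumLattice
open Summit.HubbardSuperconductivity.HubbardSuperconductivity.Theses.ParentFirstSMA
open Summit.HubbardSuperconductivity.TwTipContinuation.Negative (everyGSOrder_of_summitMatrix)
open scoped ComplexOrder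

/-! ### Rayleigh–Ritz: the top eigenvector dominates every unit Rayleigh quotient -/

/-- **Rayleigh–Ritz in the `dotProduct` language.** A Hermitian complex matrix `ρ` has, for every
unit vector `w`, a unit EIGENVECTOR `v`, `ρ v = ev • v` with `ev` real, whose eigenvalue dominates
the Rayleigh quotient of `w`: `re ⟨w, ρ w⟩ ≤ ev` (take `v` the `eigenvectorBasis` vector of the
largest eigenvalue `eigenvalues₀ 0`). Horn–Johnson (2013), Theorem 4.2.2 (c).
[cite: HornJohnson2013, Thm 4.2.2(c)] -/
theorem exists_unit_eigenvector_rayleigh_le {m : Type*} [Fintype m] [DecidableEq m]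
    {ρ : Matrix m m ℂ} (hρ : ρ.IsHermitian) (w : m → ℂ) (hw : star w ⬝ᵥ w = 1) :
    ∃ v : m → ℂ, ∃ ev : ℝ, star v ⬝ᵥ v = 1 ∧ ρ *ᵥ v = (ev : ℂ) • v ∧
      (star w ⬝ᵥ (ρ *ᵥ w)).re ≤ ev := by
  have hm : 0 < Fintype.card m := by
    rw [Fintype.card_pos_iff]
    by_contra hne
    rw [not_nonempty_iff] at hne
    have h0 : star w ⬝ᵥ w = 0 := by simp [dotProduct]
    rw [h0] at hw
    exact zero_ne_one hw
  set i : m := Fintype.equivOfCardEq (Fintype.card_fin _) ⟨0, hm⟩ with hi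
  refine ⟨⇑(hρ.eigenvectorBasis i), hρ.eigenvalues i, hρ.star_eigenvectorBasis_dotProduct_self i,
    ?_, ?_⟩
  · rw [hρ.mulVec_eigenvectorBasis i]
    ext j
    simp only [Pi.smul_apply, Complex.real_smul, smul_eq_mul]
  · have h := hρ.re_dotProduct_mulVec_le hm w hw
    have heq : hρ.eigenvalues i = hρ.eigenvalues₀ ⟨0, hm⟩ := by
      simp only [IsHermitian.eigenvalues, hi, Equiv.symm_apply_apply]
    rw [heq]
    exact h

/-! ### Every-GS order ⇒ a macroscopic `ρ₂`-eigenvalue in every sector ground state -/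

/-- **Uniform every-ground-state pair-field order forces Yang condensation in every sector ground
state.** If, eventually in even `L`, every normalised ground state `ψ` of `hubbardTorus 2 L 1 U` in
the sector `(2⌊(1-δ)L²/2⌋, S^z = 0)` has `c L⁴ ≤ re ⟨ψ, Δ_d† Δ_d ψ⟩` (`c > 0`), then every such
`ψ` has a unit `ρ₂`-eigenvector with eigenvalue `≥ (c/4) L²`: by Yang's identity
`re ⟨ψ, Δ_d† Δ_d ψ⟩ = re (φ_d† ρ₂(ψ) φ_d)` with `‖φ_d‖² = 4L²` (`L ≥ 3`), the unit pair
wavefunction `φ_d/(2L)` has Rayleigh quotient `≥ (c/4) L²`, and the top eigenvector of the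
Hermitian `ρ₂(ψ)` dominates it. Yang, Rev. Mod. Phys. 34 (1962) 694, §4.
[cite: Yang1962, §4] -/
theorem pairCondensation_of_everyGSOrder {U δ : ℝ}
    (h : ∃ c : ℝ, 0 < c ∧ ∃ L₀ : ℕ, ∀ (L : ℕ) [NeZero L], L₀ ≤ L → Even L →
        ∀ ψ : Fock (Orb (FermionTorus 2 L)), star ψ ⬝ᵥ ψ = 1 →
          IsGroundStateInSector (hubbardTorus 2 L 1 U) (2 * ⌊(1 - δ) * (L : ℝ) ^ 2 / 2⌋₊) 0 ψ →
            c * (L : ℝ) ^ 4 ≤ (expect ((pairField dWaveFormFactor L)ᴴ * pairField dWaveFormFactor L) ψ).re) :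
    ∃ c : ℝ, 0 < c ∧ ∃ L₀ : ℕ, ∀ L : ℕ, L₀ ≤ L → Even L →
      ∀ ψ : Fock (Orb (FermionTorus 2 L)), star ψ ⬝ᵥ ψ = 1 →
        IsGroundStateInSector (hubbardTorus 2 L 1 U) (2 * ⌊(1 - δ) * (L : ℝ) ^ 2 / 2⌋₊) 0 ψ →
          ∃ v : Orb (FermionTorus 2 L) × Orb (FermionTorus 2 L) → ℂ, ∃ ev : ℝ,
            star v ⬝ᵥ v = 1 ∧ twoParticleRDM ψ *ᵥ v = (ev : ℂ) • v ∧ c * (L : ℝ) ^ 2 ≤ ev := by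
  classical
  obtain ⟨c, hc, L₀, hL⟩ := h
  refine ⟨c / 4, by positivity, max L₀ 3, fun L hLle hE ψ hψ hGS => ?_⟩
  have hL3 : 3 ≤ L := le_of_max_le_right hLle
  haveI : NeZero L := ⟨by omega⟩
  have hLpos : (0 : ℝ) < (L : ℝ) := by exact_mod_cast (show 0 < L by omega)
  -- the every-GS order bound at `ψ`, rewritten through Yang's identity
  have hord := hL L (le_of_max_le_left hLle) hE ψ hψ hGS
  rw [expect_pairField_eq_dotProduct_twoParticleRDM dWaveFormFactor L
      expect_pairAnnihilator_conjTranspose_mul_holds (pairField_eq_pairAnnihilator_dWave L)] at hord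
  -- the unit pair wavefunction `w = φ_d / (2L)`
  set φ : Orb (FermionTorus 2 L) × Orb (FermionTorus 2 L) → ℂ :=
    pairFieldWavefunction dWaveFormFactor L with hφ
  have hφφ : star φ ⬝ᵥ φ = ((4 * (L : ℝ) ^ 2 : ℝ) : ℂ) := by
    rw [Matrix.star_dotProduct_self_eq_ofReal]
    congr 1
    have h4 := re_star_pairFieldWavefunction_dWave_dotProduct_self L hL3
    rw [Matrix.star_dotProduct_self_eq_ofReal, Complex.ofReal_re] at h4
    exact h4
  set a : ℝ := 1 / (2 * (L : ℝ)) with ha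
  have ha0 : 0 < a := by positivity
  set w : Orb (FermionTorus 2 L) × Orb (FermionTorus 2 L) → ℂ := (a : ℂ) • φ with hw
  have hww : star w ⬝ᵥ w = 1 := by
    rw [hw, star_smul, smul_dotProduct, dotProduct_smul, hφφ, smul_smul, smul_eq_mul]
    have hstar : star (a : ℂ) = (a : ℂ) := Complex.conj_ofReal a
    rw [hstar, ← Complex.ofReal_mul, ← Complex.ofReal_mul, ha]
    have hL0 : (L : ℝ) ≠ 0 := hLpos.ne'
    field_simp
    push_cast
    ring
  -- Rayleigh quotient of `w`: `a² re (φ_d† ρ₂ φ_d) ≥ a² c L⁴ = (c/4) L²`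
  have hρ : (twoParticleRDM ψ).IsHermitian := (PosSemidefTrace.twoParticleRDM_posSemidef ψ).isHermitian
  obtain ⟨v, ev, hv, hev, hle⟩ := exists_unit_eigenvector_rayleigh_le hρ w hww
  refine ⟨v, ev, hv, hev, le_trans ?_ hle⟩
  have hquad : (star w ⬝ᵥ (twoParticleRDM ψ *ᵥ w)).re =
      a * a * (star φ ⬝ᵥ (twoParticleRDM ψ *ᵥ φ)).re := by
    rw [hw, mulVec_smul, star_smul, smul_dotProduct, dotProduct_smul, smul_smul, smul_eq_mul]
    have hstar : star (a : ℂ) = (a : ℂ) := Complex.conj_ofReal a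
    rw [hstar, ← Complex.ofReal_mul, Complex.re_ofReal_mul]
  rw [hquad]
  calc c / 4 * (L : ℝ) ^ 2 = a * a * (c * (L : ℝ) ^ 4) := by
        rw [ha]
        field_simp
        ring
    _ ≤ a * a * (star φ ⬝ᵥ (twoParticleRDM ψ *ᵥ φ)).re :=
        mul_le_mul_of_nonneg_left hord (by positivity)

/-! ### The crux's conclusion at `(U, δ)` ⇒ the body of `stub_pairCondensation` at `δ` -/

/-- **Necessity of the condensation stub.** If the summit's matrix holds at `(U, δ)` (`δ ≥ -1`) —
every admissible `(2⌊(1-δ)L²/2⌋, S^z = 0)` ground-state sequence of the pure Hubbard torus has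
`d_{x²-y²}` pair-field long-range order along even sides, which is the conclusion of
`ParentFirstSMA.DiluteDWavePairsCondense` at `(U, δ)` — then, with one constant `c > 0`, eventually
in even `L`, EVERY normalised sector ground state has a unit `ρ₂`-eigenvector with eigenvalue
`≥ c L²`: the body of the line's stub `stub_pairCondensation` at this `δ`. (Tree normal form
`everyGSOrder_of_summitMatrix`, then `pairCondensation_of_everyGSOrder`.) Yang, Rev. Mod. Phys. 34
(1962) 694, §4. [cite: Yang1962, §4] -/
theorem pairCondensation_of_summitMatrix {U δ : ℝ} (hδ : -1 ≤ δ)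
    (hS : ∀ (N : ℕ → ℕ) (ψ : ∀ L, Fock (Orb (FermionTorus 2 L))),
        (∀ L, Even L → N L = 2 * ⌊(1 - δ) * (L : ℝ) ^ 2 / 2⌋₊ ∧ star (ψ L) ⬝ᵥ ψ L = 1 ∧
            IsGroundStateInSector (hubbardTorus 2 L 1 U) (N L) 0 (ψ L)) →
          HasLongRangeOrder (fun k => halfOpenBox 2 (2 * k))
            (fun k => torusPullback (pairFieldCorr dWaveFormFactor ψ) (2 * k))) :
    ∃ c : ℝ, 0 < c ∧ ∃ L₀ : ℕ, ∀ L : ℕ, L₀ ≤ L → Even L →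
      ∀ ψ : Fock (Orb (FermionTorus 2 L)), star ψ ⬝ᵥ ψ = 1 →
        IsGroundStateInSector (hubbardTorus 2 L 1 U) (2 * ⌊(1 - δ) * (L : ℝ) ^ 2 / 2⌋₊) 0 ψ →
          ∃ v : Orb (FermionTorus 2 L) × Orb (FermionTorus 2 L) → ℂ, ∃ ev : ℝ,
            star v ⬝ᵥ v = 1 ∧ twoParticleRDM ψ *ᵥ v = (ev : ℂ) • v ∧ c * (L : ℝ) ^ 2 ≤ ev :=
  pairCondensation_of_everyGSOrder (everyGSOrder_of_summitMatrix hδ hS)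

/-- **The crux implies an `∃ δ` form of its own condensation stub.** If
`ParentFirstSMA.DiluteDWavePairsCondense` holds then for every `U ∈ [12, 24]` satisfying its
hypotheses (a) charge-gapped parent, (b) two-hole binding, (c) `d`-coherence of the bound pair,
there is a doping `δ ∈ (0, 1/2)` and a constant `c > 0` such that, eventually in even `L`, every
normalised `(2⌊(1-δ)L²/2⌋, S^z = 0)` ground state of `hubbardTorus 2 L 1 U` has a unit
`ρ₂`-eigenvector with eigenvalue `≥ c L²` (Yang ODLRO at finite volume, uniformly over ground
states). Any proof of the crux therefore proves this condensation statement. Yang, Rev. Mod.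
Phys. 34 (1962) 694, §4. [cite: Yang1962, §4] -/
theorem pairCondensation_of_diluteDWavePairsCondense : Summit.HubbardSuperconductivity.HubbardSuperconductivity.Theses.ParentFirstSMA.DiluteDWavePairsCondense → ∀ U : ℝ, 12 ≤ U → U ≤ 24 → (∃ g : ℝ, 0 < g ∧ ∃ L₀ : ℕ, ∀ L : ℕ, L₀ ≤ L → Even L → g ≤ chargeGap (fermionTorusGraph 2 L) 1 U (L ^ 2)) → (∃ b : ℝ, 0 < b ∧ ∃ L₀ : ℕ, ∀ L : ℕ, L₀ ≤ L → Even L → b ≤ 2 * groundEnergyAt (fermionTorusGraph 2 L) 1 U (L ^ 2 - 1) - groundEnergyAt (fermionTorusGraph 2 L) 1 U (L ^ 2) - groundEnergyAt (fermionTorusGraph 2 L) 1 U (L ^ 2 - 2)) → (∃ z : ℝ, 0 < z ∧ ∃ L₀ : ℕ, ∀ (L : ℕ) [NeZero L], L₀ ≤ L → Even L → ∃ φ₂ ψ₀ : Fock (Orb (FermionTorus 2 L)), IsGroundState (hubbardTorus 2 L 1 U) (L ^ 2 - 2) φ₂ ∧ star φ₂ ⬝ᵥ φ₂ = 1 ∧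 IsGroundState (hubbardTorus 2 L 1 U) (L ^ 2) ψ₀ ∧ star ψ₀ ⬝ᵥ ψ₀ = 1 ∧ z * (L : ℝ) ^ 2 ≤ ‖star φ₂ ⬝ᵥ (pairField dWaveFormFactor L *ᵥ ψ₀)‖ ^ 2) → ∃ δ ∈ Set.Ioo (0 : ℝ) (1 / 2), ∃ c : ℝ, 0 < c ∧ ∃ L₀ : ℕ, ∀ L : ℕ, L₀ ≤ L → Even L → ∀ ψ : Fock (Orb (FermionTorus 2 L)), star ψ ⬝ᵥ ψ = 1 → IsGroundStateInSector (hubbardTorus 2 L 1 U) (2 * ⌊(1 - δ) * (L : ℝ) ^ 2 / 2⌋₊) 0 ψ → ∃ v : Orb (FermionTorus 2 L) × Orb (FermionTorus 2 L) → ℂ, ∃ ev : ℝ, star v ⬝ᵥ v = 1 ∧ twoParticleRDM ψ *ᵥ v = (ev : ℂ) • v ∧ c * (L : ℝ) ^ 2 ≤ ev := by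
  intro h U hU12 hU24 hA hB hC
  obtain ⟨δ, hδ, hS⟩ := h U hU12 hU24 hA hB hC
  exact ⟨δ, hδ, pairCondensation_of_summitMatrix (by linarith [hδ.1]) hS⟩

end Summit.HubbardSuperconductivity.HubbardSuperconductivity.Theorems.ParentFirstSMA

end
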